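import Summits.QuantumFields.BalabanUV.Beta.EriceRemainderEnclosureHistoryFading
import Literature.MathematicalPhysics.QuantumFieldTheory.Balaban1983to89.T4ContinuumCoupling

/-!
# EriceRemainderEnclosureHistoryFadingContinuum — (E36b) NODE U2'S OUTPUT SHAPE AND THE CONTINUUM RUNNING COUPLING FROM `FadingMemory`
# WITH AN ARBITRARY CONSTANT: ONE ratio `κ < 1`, chosen BEFORE the family, the moduli, the cutoff and the runs, such that the ROW
# smallness `4·M·U < 1` of the junction's currency alone gives `T4CauchySum.InjectedRate (2c∕(1−θ)) 0 κ` for the coupling discrepancies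
# of consecutive cutoffs and hence `T4ContinuumCoupling.ContinuumRunning` BY NAME; the same from a memory of finite DEPTH `N` at the
# explicit ratio `κ`, `κ^N ≥ 2·M·U`

Cell `pub-balaban`, β-function sub-cell, BINDER row D4 «RemainderConst leaves for Bałaban's split» (`HOME/BINDER-OWNERS.md`; owner
lineage `b2b-balaban-beta-an4`; this file by co-owner #2 lineage `b2b-balaban-beta-d4-p2`, generation 38), β-FLOW TEAM duty (1),
FREEZE (0) honoured (def-free; no new leaf, no new hypothesis shape).  The END of station (E36): composition BY NAME of (E36a)
`EriceRemainderEnclosureHistoryFading.disc_le_geom_of_fading_sign` ∕ `disc_le_geom_of_expMoment_sign` (the geometric two-run matching rate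
from an exponential age-moment of the history modulus) with node U2's typed source `T4CauchySum.InjectedRate` and the continuum read-out
`T4ContinuumCoupling.continuumRunning_of_injectedRate` (lineage `b2b-balaban-t4-ne4-p2`), plus the finite-depth supplier (§0) and the
elementary choice of the ratio (§1).

HONEST FRAMING (page 1, verbatim and binding).  *"Discharging BetaPertH makes Bałaban's UV stability UNCONDITIONAL — a real
constructive-QFT result; it is NOT the continuum limit and NOT the Clay problem."*  THIS FILE DISCHARGES NOTHING OF THE KIND.  Every
β-side input is a NAMED BINDER on an ABSTRACT family `β : FlowStep.HBeta`, NOT PRINTED and NOT asserted for [I] (1.22): node U2's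
`ScaleShiftRate c θ γ β` (GAPS G-t4-U2-1), `HistLipschitz Λ γ β` ∕ `FadingMemory C θ Λ` ∕ a row budget `M` (GAPS G-t4-U2-2),
`EventualLowerH b γ k₀ β` (shape of (0.31)'s lower half; [Balaban1989LargeFieldII] p. 355: the β-function paper «has not been published
yet»), the sign `BetaLowerH 0 γ β`, the run-wise recursion (0.20) with ONE history family for all cutoffs and the infrared pin
`g K K = g_IR` (Theorem 2's renormalization condition, here a hypothesis).  Nothing of Bałaban's is quoted newly (loci verbatim in the
headers of `FlowStep` ∕ `T4CouplingMatching` ∕ `T4ContinuumCoupling`).  Row D4 class UNCHANGED (critical-path width 0; instance 0∕1; D4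
DISCHARGE NO DATE).  HONEST DEPENDENCY: continuum YM on T⁴ ⇐ BetaPertH ∧ nine spine estimates (0/9 proved); BetaPertH ⇐ (D1) ∧ (D4) ∧
CAP+tail; G-an2-4 gates asym, D1 and NE2/3/4.

THE POINT (census sense (α)).  Node U2's `injectedRate_of_runs_eventual` ∕ `T4ContinuumCoupling.continuumRunning_of_runs_eventual` take
`FadingMemory C θ Λ` WITH `C·((k₀+1)γ³ + 2γ∕b) ≤ (1−θ)∕2` and deliver `InjectedRate (2c∕(1−θ)) 0 θ` and the continuum running coupling with
the tail `Cθ^n∕(1−θ)`.  Here (sign form): `FadingMemory C θ Λ` with ANY constant `C ≥ 0`, the k-uniform ROW total weight `M` of the modulus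
((D4-J2)'s junction currency, the currency of (E32)∕(E33)) with `4·M·((k₀+1)γ³ + 2γ∕b) < 1`, the sign and the eventual floor deliver
`InjectedRate (2c∕(1−θ)) 0 κ` for ONE `κ ∈ ]θ, 1[` depending on `θ, C, M` and the row smallness only (§1: `κ = max((1+θ)∕2, (4MU)^{1∕(a+1)})`
with `C·θ^{a+1} ≤ M(1−θ)∕2`) — hence `ContinuumRunning β g g_IR γ b` BY NAME: the continuum coupling at every physical scale with a
GEOMETRIC tail, the limit flow, logarithmic asymptotic freedom.  So the typed geometric currency of nodes U2∕U6 needs the decay of the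
memory in the age only QUALITATIVELY (a finite fading constant, or a finite depth); the price of a large fading constant ∕ a deep memory
is the RATIO (`log(1∕κ) ≍ log(1∕θ)·log(1∕(4MU))∕log(C∕M)`, resp. `κ^N = 2MU`), never an admission condition — while WITHOUT any such
moment the shape is stretched, exponent ½, sharp ((E33)∕(E35)), and the ratio can NOT be uniform in `C` ((E36c)).

WHAT IS PROVED ([folklore] real analysis + by-name composition; 0 `def`, 0 sorry; nothing of [I] asserted).
 §0 `expMoment_of_depth` (depth `N` + rows `≤ M` ⟹ `Σ_{i≤l} Λ l i κ^i ≤ (M∕κ^N)κ^l`), **`disc_le_geom_of_depth_sign`** (two pinned runs, sign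
    form: `2·U·M ≤ κ^N` ⟹ `disc ≤ (2c∕(1−θ))κ^j`, (E36a) `disc_le_geom_of_expMoment_sign` BY NAME).
 §1 `exists_root` (`κ ∈ [max(θ,(1+θ)∕2), 1[` with `q ≤ κ^n`), **`exists_ratio`** (`θ < κ < 1`, `q ≤ κ^a`, `C·θ^{a+1}∕(κ−θ) ≤ M`).
 §2 **`geometric_uniform_fading_sign`** (ONE `κ` before `∀ β Λ K gA gB`), **`injectedRate_of_expMoment_sign`** (the one door: any exponential
    age-moment `M_κ` with `2UM_κ ≤ 1` ⟹ node U2's `InjectedRate (2c∕(1−θ)) 0 κ`), `injectedRate_of_fading_sign_at` (explicit `κ`, `a`),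
    **`injectedRate_of_fading_sign`**, **`continuumRunning_of_fading_sign`**; `injectedRate_of_depth_sign` (explicit `κ`, `κ^N ≥ 2MU`),
    `continuumRunning_of_depth_sign`.
-/

noncomputable section
open Finset

namespace Summit.QuantumFields.BalabanUV.Beta.EriceRemainderEnclosureHistoryFadingContinuum

open Literature.MathematicalPhysics.QuantumFieldTheory.Balaban1983to89
open Literature.MathematicalPhysics.QuantumFieldTheory.Balaban1983to89.FlowStep
open Literature.MathematicalPhysics.QuantumFieldTheory.Balaban1983to89.T4CouplingMatching
open Literature.MathematicalPhysics.QuantumFieldTheory.Balaban1983to89.T4CauchySum (InjectedRate)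
open Literature.MathematicalPhysics.QuantumFieldTheory.Balaban1983to89.T4ContinuumCoupling
  (ContinuumRunning continuumRunning_of_injectedRate)
open Summit.QuantumFields.BalabanUV.Beta.EriceRemainderEnclosureHistoryFading
  (disc_le_geom_of_expMoment_sign disc_le_geom_of_fading_sign)

/-! ## §0 Finite memory depth: the exponential moment and the run-level rate ((E36a)'s kernel by name) -/

/-- **A MEMORY OF FINITE DEPTH HAS EVERY EXPONENTIAL MOMENT.**  If `Λ l i ≥ 0`, `Λ l i = 0` whenever `i + N < l` (the
β-function at scale `l` does not depend on couplings older than `N` scales) and `Σ_{i≤l} Λ l i ≤ M`, then for every `0 < κ ≤ 1`: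
`Σ_{i≤l} Λ l i·κ^i ≤ (M∕κ^N)·κ^l`. [folklore] -/
theorem expMoment_of_depth {Λ : ℕ → ℕ → ℝ} {κ M : ℝ} (N : ℕ) {l : ℕ} (hκ0 : 0 < κ) (hκ1 : κ ≤ 1)
    (hΛ0 : ∀ i, i ≤ l → 0 ≤ Λ l i) (hdepth : ∀ i, i + N < l → Λ l i = 0)
    (hrow : ∑ i ∈ range (l + 1), Λ l i ≤ M) :
    ∑ i ∈ range (l + 1), Λ l i * κ ^ i ≤ M / κ ^ N * κ ^ l := by
  have hκN : 0 < κ ^ N := pow_pos hκ0 N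
  have hterm : ∀ i ∈ range (l + 1), Λ l i * κ ^ i ≤ Λ l i * (κ ^ l / κ ^ N) := by
    intro i hi
    have hil : i ≤ l := Nat.lt_succ_iff.mp (mem_range.mp hi)
    by_cases h : i + N < l
    · rw [hdepth i h, zero_mul, zero_mul]
    · refine mul_le_mul_of_nonneg_left ?_ (hΛ0 i hil)
      rw [le_div_iff₀ hκN, ← pow_add]
      exact pow_le_pow_of_le_one hκ0.le hκ1 (by omega)
  calc ∑ i ∈ range (l + 1), Λ l i * κ ^ i ≤ ∑ i ∈ range (l + 1), Λ l i * (κ ^ l / κ ^ N) := sum_le_sum hterm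
    _ = (∑ i ∈ range (l + 1), Λ l i) * (κ ^ l / κ ^ N) := by rw [sum_mul]
    _ ≤ M * (κ ^ l / κ ^ N) := mul_le_mul_of_nonneg_right hrow (by positivity)
    _ = M / κ ^ N * κ ^ l := by
        field_simp

/-- **FINITE MEMORY DEPTH — SIGN FORM.**  Two pinned runs under `ScaleShiftRate c θ γ β`, `HistLipschitz Λ γ β` with `Λ ≥ 0`, DEPTH `N`
(`Λ k i = 0` for `i + N < k`: `β_{k+1}` reads only `g_{k−N}, …, g_k`) and rows `≤ M`, the sign, the eventual floor (`U = (k₀+1)γ³ + 2γ∕b`);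
any ratio `θ ≤ κ ≤ 1`, `κ > 0`, with `2·U·M ≤ κ^N`.  THEN `disc gA gB j ≤ (2c∕(1−θ))·κ^j` for every `j ≤ K`: a history dependence of total
strength `M` reaching `N` scales back costs the ratio `max(θ, (2UM)^{1∕N})` — the η-exponent is inversely proportional to the DEPTH of the
memory; no decay in the age is involved. [cite: Balaban1987RG1, (0.20) p.256 and (0.31) p.259] -/
theorem disc_le_geom_of_depth_sign {β : HBeta} {γ b c θ κ M : ℝ} {k₀ N : ℕ} {Λ : ℕ → ℕ → ℝ} {K : ℕ} {gA gB : ℕ → ℝ}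
    (hγ : 0 < γ) (hb : 0 < b) (hc : 0 ≤ c) (hθ0 : 0 ≤ θ) (hθ1 : θ < 1) (hθκ : θ ≤ κ) (hκ0 : 0 < κ) (hκ1 : κ ≤ 1)
    (hA : RGEqH K β gA) (hB : RGEqH (K + 1) β gB)
    (hAbox : ∀ i, i ≤ K → 0 < gA i ∧ gA i ≤ γ) (hBbox : ∀ i, i ≤ K + 1 → 0 < gB i ∧ gB i ≤ γ)
    (hpin : gA K = gB (K + 1))
    (hS : ScaleShiftRate c θ γ β) (hL : HistLipschitz Λ γ β) (hΛ : ∀ k i, i ≤ k → 0 ≤ Λ k i)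
    (hdepth : ∀ k i, i + N < k → Λ k i = 0) (hrow : ∀ k, ∑ i ∈ range (k + 1), Λ k i ≤ M)
    (hsign : BetaLowerH 0 γ β) (hlo : EventualLowerH b γ k₀ β)
    (hsmall : 2 * ((((k₀ : ℝ) + 1) * γ ^ 3 + 2 * γ / b) * M) ≤ κ ^ N) :
    ∀ j, j ≤ K → disc gA gB j ≤ 2 * c / (1 - θ) * κ ^ j := by
  have hκN : 0 < κ ^ N := pow_pos hκ0 N
  have hexp : ∀ k, ∑ i ∈ range (k + 1), Λ k i * κ ^ i ≤ M / κ ^ N * κ ^ k :=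
    fun k => expMoment_of_depth N hκ0 hκ1 (fun i hi => hΛ k i hi) (fun i hi => hdepth k i hi) (hrow k)
  have hsmall' : 2 * ((((k₀ : ℝ) + 1) * γ ^ 3 + 2 * γ / b) * (M / κ ^ N)) ≤ 1 := by
    rw [show 2 * ((((k₀ : ℝ) + 1) * γ ^ 3 + 2 * γ / b) * (M / κ ^ N))
        = 2 * ((((k₀ : ℝ) + 1) * γ ^ 3 + 2 * γ / b) * M) / κ ^ N by ring]
    rwa [div_le_one hκN]
  exact disc_le_geom_of_expMoment_sign hγ hb hc hθ0 hθ1 hθκ hκ0 hκ1 hA hB hAbox hBbox hpin hS hL hΛ hexp hsign hlo hsmall'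

/-! ## §1 The choice of the ratio -/

/-- A root below one: for `θ < 1`, `0 ≤ q < 1` and any `n` there is `κ` with `θ < κ < 1`, `(1+θ)∕2 ≤ κ` and `q ≤ κ^n`
(`κ = max((1+θ)∕2, q^{1∕(n+1)})`). [folklore] -/
theorem exists_root {θ q : ℝ} (n : ℕ) (hθ1 : θ < 1) (hq0 : 0 ≤ q) (hq1 : q < 1) :
    ∃ κ : ℝ, θ < κ ∧ κ < 1 ∧ (1 + θ) / 2 ≤ κ ∧ q ≤ κ ^ n := by
  obtain ⟨κ₂, hκ₂⟩ : ∃ κ₂ : ℝ, κ₂ = q ^ (((n : ℝ) + 1)⁻¹) := ⟨_, rfl⟩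
  have hκ₂0 : 0 ≤ κ₂ := by rw [hκ₂]; exact Real.rpow_nonneg hq0 _
  have hκ₂1 : κ₂ < 1 := by rw [hκ₂]; exact Real.rpow_lt_one hq0 hq1 (by positivity)
  have hpow : κ₂ ^ (n + 1) = q := by
    have h := Real.rpow_inv_natCast_pow hq0 (Nat.succ_ne_zero n)
    rw [hκ₂]
    simpa [Nat.cast_succ] using h
  refine ⟨max ((1 + θ) / 2) κ₂, lt_of_lt_of_le (by linarith) (le_max_left _ _), max_lt (by linarith) hκ₂1,
    le_max_left _ _, ?_⟩
  calc q = κ₂ ^ (n + 1) := hpow.symm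
    _ ≤ κ₂ ^ n := pow_le_pow_of_le_one hκ₂0 hκ₂1.le (Nat.le_succ n)
    _ ≤ (max ((1 + θ) / 2) κ₂) ^ n := pow_le_pow_left₀ hκ₂0 (le_max_right _ _) n

/-- **THE RATIO FOR A GIVEN FADING CONSTANT.**  For `0 ≤ θ < 1`, any cap constant `C ≥ 0`, a row budget `M > 0` and a target `0 ≤ q < 1`
there are a ratio `θ < κ < 1` and a window `a` with `q ≤ κ^a` and `C·θ^{a+1}∕(κ−θ) ≤ M` — take `a` with `C·θ^{a+1} ≤ M(1−θ)∕2`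
(`a ≍ log(C∕M)∕log(1∕θ)`), then `κ = max((1+θ)∕2, q^{1∕(a+1)})`; so `log(1∕κ) ≥ min(log(2∕(1+θ)), log(1∕q)∕(a+1))`. [folklore] -/
theorem exists_ratio {θ C M q : ℝ} (hθ0 : 0 ≤ θ) (hθ1 : θ < 1) (hC : 0 ≤ C) (hM : 0 < M) (hq0 : 0 ≤ q) (hq1 : q < 1) :
    ∃ (κ : ℝ) (a : ℕ), θ < κ ∧ κ < 1 ∧ q ≤ κ ^ a ∧ C * θ ^ (a + 1) / (κ - θ) ≤ M := by
  have h1θ : 0 < 1 - θ := by linarith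
  have hx : 0 < M * (1 - θ) / (2 * (C + 1)) := div_pos (mul_pos hM h1θ) (by positivity)
  obtain ⟨a, ha⟩ : ∃ a : ℕ, θ ^ a < M * (1 - θ) / (2 * (C + 1)) := exists_pow_lt_of_lt_one hx hθ1
  obtain ⟨κ, hθκ, hκ1, hκhalf, hqκ⟩ := exists_root a hθ1 hq0 hq1
  refine ⟨κ, a, hθκ, hκ1, hqκ, ?_⟩
  have hκθpos : 0 < κ - θ := by linarith
  have hC1 : (C + 1) ≠ 0 := by positivity
  have h1 : C * θ ^ (a + 1) ≤ M * (1 - θ) / 2 := by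
    have hθa : θ ^ (a + 1) ≤ θ ^ a := pow_le_pow_of_le_one hθ0 hθ1.le (Nat.le_succ a)
    calc C * θ ^ (a + 1) ≤ (C + 1) * θ ^ a := by nlinarith [pow_nonneg hθ0 (a + 1), pow_nonneg hθ0 a]
      _ ≤ (C + 1) * (M * (1 - θ) / (2 * (C + 1))) := mul_le_mul_of_nonneg_left ha.le (by positivity)
      _ = M * (1 - θ) / 2 := by field_simp
  rw [div_le_iff₀ hκθpos]
  calc C * θ ^ (a + 1) ≤ M * (1 - θ) / 2 := h1
    _ ≤ M * (κ - θ) := by nlinarith [hM.le, hκhalf]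

/-! ## §2 One ratio before the class; node U2's output shape; the continuum running coupling (by name) -/

/-- **ONE RATIO BEFORE THE CLASS (fading memory with an arbitrary constant, sign form).**  For `c ≥ 0`, `0 ≤ θ < 1`, box `γ > 0`,
floor `b > 0`, ANY fading constant `C ≥ 0` and a row budget `M > 0` with the ROW smallness `4·M·((k₀+1)γ³ + 2γ∕b) < 1`, there is ONE
ratio `θ < κ < 1` such that for EVERY history family `β`, moduli `Λ`, cutoff `K` and pinned runs `gA` (K steps) ∕ `gB` (K + 1 steps) of
(0.20) in ]0,γ] with `ScaleShiftRate c θ γ β`, `HistLipschitz Λ γ β`, `FadingMemory C θ Λ`, rows `≤ M`, `BetaLowerH 0 γ β`,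
`EventualLowerH b γ k₀ β`: `disc gA gB j ≤ (2c∕(1−θ))·κ^j` for all `j ≤ K` — node U2's constant, K-uniformly, with NO smallness on `C`
((E36a) `disc_le_geom_of_fading_sign` + §1 `exists_ratio` with `q = 4MU`).  Contrast (E35c) `not_geometric`: WITHOUT the fading binder no
such `κ` exists for the class. [cite: Balaban1987RG1, (0.20) p.256 and (0.31) p.259] -/
theorem geometric_uniform_fading_sign {c θ γ b C M : ℝ} {k₀ : ℕ} (hc : 0 ≤ c) (hθ0 : 0 ≤ θ) (hθ1 : θ < 1)
    (hγ : 0 < γ) (hb : 0 < b) (hC : 0 ≤ C) (hM : 0 < M)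
    (hsmall : 4 * (M * (((k₀ : ℝ) + 1) * γ ^ 3 + 2 * γ / b)) < 1) :
    ∃ κ : ℝ, θ < κ ∧ κ < 1 ∧ ∀ (β : HBeta) (Λ : ℕ → ℕ → ℝ) (K : ℕ) (gA gB : ℕ → ℝ),
      RGEqH K β gA → RGEqH (K + 1) β gB →
      (∀ i, i ≤ K → 0 < gA i ∧ gA i ≤ γ) → (∀ i, i ≤ K + 1 → 0 < gB i ∧ gB i ≤ γ) → gA K = gB (K + 1) →
      ScaleShiftRate c θ γ β → HistLipschitz Λ γ β → FadingMemory C θ Λ →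
      (∀ k, ∑ i ∈ range (k + 1), Λ k i ≤ M) → BetaLowerH 0 γ β → EventualLowerH b γ k₀ β →
      ∀ j, j ≤ K → disc gA gB j ≤ 2 * c / (1 - θ) * κ ^ j := by
  have hU0 : 0 < ((k₀ : ℝ) + 1) * γ ^ 3 + 2 * γ / b := by positivity
  obtain ⟨κ, a, hθκ, hκ1, hqκ, hwin⟩ :=
    exists_ratio (q := 4 * (M * (((k₀ : ℝ) + 1) * γ ^ 3 + 2 * γ / b))) hθ0 hθ1 hC hM (by positivity) hsmall
  refine ⟨κ, hθκ, hκ1, fun β Λ K gA gB hA hB hAbox hBbox hpin hS hL hF hrow hsign hlo => ?_⟩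
  refine disc_le_geom_of_fading_sign (a := a) hγ hb hc hθ0 hθκ hκ1.le hA hB hAbox hBbox hpin hS hL hF hrow hsign hlo ?_
  calc 2 * ((((k₀ : ℝ) + 1) * γ ^ 3 + 2 * γ / b) * (M + C * θ ^ (a + 1) / (κ - θ)))
      ≤ 2 * ((((k₀ : ℝ) + 1) * γ ^ 3 + 2 * γ / b) * (M + M)) := by
        have h := add_le_add_left hwin M
        nlinarith [hU0.le]
    _ = 4 * (M * (((k₀ : ℝ) + 1) * γ ^ 3 + 2 * γ / b)) := by ring
    _ ≤ κ ^ a := hqκ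

/-- **NODE U2'S OUTPUT SHAPE FROM A SMALL EXPONENTIAL AGE-MOMENT (the exact currency; sign form, explicit ratio).**  A family of
runs `g : ℕ → ℕ → ℝ` of (0.20) in ]0,γ], pinned `g K K = g_IR`; NE4 as `ScaleShiftRate c θ γ β` (`0 ≤ θ < 1`); `HistLipschitz Λ γ β`, `Λ ≥ 0`,
with the κ-tilted row budget `Σ_{i≤k} Λ k i·κ^i ≤ M_κ·κ^k` (`θ ≤ κ ≤ 1`, `κ > 0`); the sign and the eventual floor; SMALLNESS
`2·((k₀+1)γ³ + 2γ∕b)·M_κ ≤ 1`.  THEN `T4CauchySum.InjectedRate (2c∕(1−θ)) 0 κ (fun K j ↦ disc (g K) (g (K+1)) j)` ((E36a)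
`disc_le_geom_of_expMoment_sign` BY NAME) — every supplier of an exponential age-moment (fading caps, finite depth, …) feeds node U2's
typed source through this one door. [cite: Balaban1987RG1, (0.20) p.256 and Thm 2 p.259] -/
theorem injectedRate_of_expMoment_sign {β : HBeta} {γ b c θ κ Mκ : ℝ} {k₀ : ℕ} {Λ : ℕ → ℕ → ℝ} (g : ℕ → ℕ → ℝ) (gIR : ℝ)
    (hγ : 0 < γ) (hb : 0 < b) (hc : 0 ≤ c) (hθ0 : 0 ≤ θ) (hθ1 : θ < 1) (hθκ : θ ≤ κ) (hκ0 : 0 < κ) (hκ1 : κ ≤ 1)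
    (hrun : ∀ K, RGEqH K β (g K)) (hbox : ∀ K i, i ≤ K → 0 < g K i ∧ g K i ≤ γ) (hpin : ∀ K, g K K = gIR)
    (hS : ScaleShiftRate c θ γ β) (hL : HistLipschitz Λ γ β) (hΛ : ∀ k i, i ≤ k → 0 ≤ Λ k i)
    (hexp : ∀ k, ∑ i ∈ range (k + 1), Λ k i * κ ^ i ≤ Mκ * κ ^ k)
    (hsign : BetaLowerH 0 γ β) (hlo : EventualLowerH b γ k₀ β)
    (hsmall : 2 * ((((k₀ : ℝ) + 1) * γ ^ 3 + 2 * γ / b) * Mκ) ≤ 1) :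
    InjectedRate (2 * c / (1 - θ)) 0 κ (fun K j => disc (g K) (g (K + 1)) j) := by
  intro K j hj
  refine ⟨disc_nonneg _ _ _, ?_⟩
  have h := disc_le_geom_of_expMoment_sign hγ hb hc hθ0 hθ1 hθκ hκ0 hκ1 (hrun K) (hrun (K + 1)) (hbox K) (hbox (K + 1))
    ((hpin K).trans (hpin (K + 1)).symm) hS hL hΛ hexp hsign hlo hsmall j hj
  simpa using h

/-- **NODE U2'S OUTPUT SHAPE AT AN EXPLICIT RATIO (fading memory with an arbitrary constant, sign form).**  A family of runs
`g : ℕ → ℕ → ℝ` of (0.20) (`RGEqH K β (g K)` for every cutoff `K`, ONE history family `β`) in ]0,γ], pinned `g K K = g_IR`; NE4 as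
`ScaleShiftRate c θ γ β`; `HistLipschitz Λ γ β` with `FadingMemory C θ Λ` (ANY `C`) and rows `≤ M`; the sign and the eventual floor; a
window `a` and a ratio `θ < κ ≤ 1` with `2·((k₀+1)γ³ + 2γ∕b)·(M + C·θ^{a+1}∕(κ−θ)) ≤ κ^a`.  THEN
`T4CauchySum.InjectedRate (2c∕(1−θ)) 0 κ (fun K j ↦ disc (g K) (g (K+1)) j)` — node U2's typed source with ITS constant and the ratio `κ`.
Bookkeeping over UNPRINTED inputs; nothing of [I] is asserted. [cite: Balaban1987RG1, (0.20) p.256 and Thm 2 p.259] -/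
theorem injectedRate_of_fading_sign_at {β : HBeta} {γ b c θ κ C M : ℝ} {k₀ a : ℕ} {Λ : ℕ → ℕ → ℝ} (g : ℕ → ℕ → ℝ)
    (gIR : ℝ) (hγ : 0 < γ) (hb : 0 < b) (hc : 0 ≤ c) (hθ0 : 0 ≤ θ) (hθκ : θ < κ) (hκ1 : κ ≤ 1)
    (hrun : ∀ K, RGEqH K β (g K)) (hbox : ∀ K i, i ≤ K → 0 < g K i ∧ g K i ≤ γ) (hpin : ∀ K, g K K = gIR)
    (hS : ScaleShiftRate c θ γ β) (hL : HistLipschitz Λ γ β) (hF : FadingMemory C θ Λ)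
    (hrow : ∀ k, ∑ i ∈ range (k + 1), Λ k i ≤ M) (hsign : BetaLowerH 0 γ β) (hlo : EventualLowerH b γ k₀ β)
    (hsmall : 2 * ((((k₀ : ℝ) + 1) * γ ^ 3 + 2 * γ / b) * (M + C * θ ^ (a + 1) / (κ - θ))) ≤ κ ^ a) :
    InjectedRate (2 * c / (1 - θ)) 0 κ (fun K j => disc (g K) (g (K + 1)) j) := by
  intro K j hj
  refine ⟨disc_nonneg _ _ _, ?_⟩
  have h := disc_le_geom_of_fading_sign hγ hb hc hθ0 hθκ hκ1 (hrun K) (hrun (K + 1)) (hbox K) (hbox (K + 1))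
    ((hpin K).trans (hpin (K + 1)).symm) hS hL hF hrow hsign hlo hsmall j hj
  simpa using h

/-- **NODE U2'S OUTPUT SHAPE FROM FADING MEMORY WITH AN ARBITRARY CONSTANT (sign form).**  As `injectedRate_of_fading_sign_at`, with
the window and the ratio CHOSEN (§1): under `FadingMemory C θ Λ` (ANY `C ≥ 0`), rows `≤ M` (`M > 0`) and the ROW smallness
`4·M·((k₀+1)γ³ + 2γ∕b) < 1` there is `θ < κ < 1` with `T4CauchySum.InjectedRate (2c∕(1−θ)) 0 κ (fun K j ↦ disc (g K) (g (K+1)) j)`.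
Node U2's `injectedRate_of_runs_eventual` asks `C·((k₀+1)γ³ + 2γ∕b) ≤ (1−θ)∕2` instead (and no sign); here the fading constant is free
and is paid in `κ`. [cite: Balaban1987RG1, (0.20) p.256 and Thm 2 p.259] -/
theorem injectedRate_of_fading_sign {β : HBeta} {γ b c θ C M : ℝ} {k₀ : ℕ} {Λ : ℕ → ℕ → ℝ} (g : ℕ → ℕ → ℝ) (gIR : ℝ)
    (hγ : 0 < γ) (hb : 0 < b) (hθ0 : 0 ≤ θ) (hθ1 : θ < 1) (hc : 0 ≤ c) (hC : 0 ≤ C) (hM : 0 < M)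
    (hrun : ∀ K, RGEqH K β (g K)) (hbox : ∀ K i, i ≤ K → 0 < g K i ∧ g K i ≤ γ) (hpin : ∀ K, g K K = gIR)
    (hS : ScaleShiftRate c θ γ β) (hL : HistLipschitz Λ γ β) (hF : FadingMemory C θ Λ)
    (hrow : ∀ k, ∑ i ∈ range (k + 1), Λ k i ≤ M) (hsign : BetaLowerH 0 γ β) (hlo : EventualLowerH b γ k₀ β)
    (hsmall : 4 * (M * (((k₀ : ℝ) + 1) * γ ^ 3 + 2 * γ / b)) < 1) :
    ∃ κ : ℝ, θ < κ ∧ κ < 1 ∧ InjectedRate (2 * c / (1 - θ)) 0 κ (fun K j => disc (g K) (g (K + 1)) j) := by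
  obtain ⟨κ, hθκ, hκ1, h⟩ := geometric_uniform_fading_sign hc hθ0 hθ1 hγ hb hC hM hsmall
  refine ⟨κ, hθκ, hκ1, fun K j hj => ⟨disc_nonneg _ _ _, ?_⟩⟩
  have h' := h β Λ K (g K) (g (K + 1)) (hrun K) (hrun (K + 1)) (hbox K) (hbox (K + 1))
    ((hpin K).trans (hpin (K + 1)).symm) hS hL hF hrow hsign hlo j hj
  simpa using h'

/-- **THE CONTINUUM RUNNING COUPLING FROM FADING MEMORY WITH AN ARBITRARY CONSTANT (sign form; `T4ContinuumCoupling` BY NAME).**  The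
run-wise recursion (0.20) with the pin, NE4 `ScaleShiftRate c θ γ β`, `HistLipschitz Λ γ β` with `FadingMemory C θ Λ` — ANY `C ≥ 0` —,
rows `≤ M`, the sign `BetaLowerH 0 γ β`, `EventualLowerH b γ k₀ β` with `b > 0`, and the ROW smallness `4·M·((k₀+1)γ³ + 2γ∕b) < 1` —
every one UNPRINTED and a binder — give `T4ContinuumCoupling.ContinuumRunning β g g_IR γ b`: convergence of the couplings at every
physical scale with a GEOMETRIC tail, the limit flow, logarithmic asymptotic freedom (`continuumRunning_of_injectedRate` BY NAME).  The
typed geometric currency of nodes U2∕U6 thus needs the decay of the memory only qualitatively. [folklore] -/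
theorem continuumRunning_of_fading_sign {β : HBeta} {γ b c θ C M : ℝ} {k₀ : ℕ} {Λ : ℕ → ℕ → ℝ} (g : ℕ → ℕ → ℝ) (gIR : ℝ)
    (hγ : 0 < γ) (hb : 0 < b) (hθ0 : 0 ≤ θ) (hθ1 : θ < 1) (hc : 0 ≤ c) (hC : 0 ≤ C) (hM : 0 < M)
    (hrun : ∀ K, RGEqH K β (g K)) (hbox : ∀ K i, i ≤ K → 0 < g K i ∧ g K i ≤ γ) (hpin : ∀ K, g K K = gIR)
    (hS : ScaleShiftRate c θ γ β) (hL : HistLipschitz Λ γ β) (hF : FadingMemory C θ Λ)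
    (hrow : ∀ k, ∑ i ∈ range (k + 1), Λ k i ≤ M) (hsign : BetaLowerH 0 γ β) (hlo : EventualLowerH b γ k₀ β)
    (hsmall : 4 * (M * (((k₀ : ℝ) + 1) * γ ^ 3 + 2 * γ / b)) < 1) :
    ContinuumRunning β g gIR γ b := by
  obtain ⟨κ, _, hκ1, hinj⟩ :=
    injectedRate_of_fading_sign g gIR hγ hb hθ0 hθ1 hc hC hM hrun hbox hpin hS hL hF hrow hsign hlo hsmall
  exact continuumRunning_of_injectedRate hκ1 hinj hrun hbox hpin hlo hb.le

/-- **NODE U2'S OUTPUT SHAPE FROM A MEMORY OF FINITE DEPTH (sign form, explicit ratio).**  A family of pinned runs of (0.20) in ]0,γ]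
as above; NE4 `ScaleShiftRate c θ γ β` (`0 ≤ θ < 1`); `HistLipschitz Λ γ β` with `Λ ≥ 0`, DEPTH `N` (`Λ k i = 0` for `i + N < k`) and rows
`≤ M`; the sign and the eventual floor; a ratio `θ ≤ κ ≤ 1`, `κ > 0`, with `2·((k₀+1)γ³ + 2γ∕b)·M ≤ κ^N`.  THEN
`T4CauchySum.InjectedRate (2c∕(1−θ)) 0 κ (fun K j ↦ disc (g K) (g (K+1)) j)`: a history dependence of total strength `M` and depth `N`
costs the ratio `max(θ, (2MU)^{1∕N})` and nothing else. [cite: Balaban1987RG1, (0.20) p.256 and Thm 2 p.259] -/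
theorem injectedRate_of_depth_sign {β : HBeta} {γ b c θ κ M : ℝ} {k₀ N : ℕ} {Λ : ℕ → ℕ → ℝ} (g : ℕ → ℕ → ℝ) (gIR : ℝ)
    (hγ : 0 < γ) (hb : 0 < b) (hc : 0 ≤ c) (hθ0 : 0 ≤ θ) (hθ1 : θ < 1) (hθκ : θ ≤ κ) (hκ0 : 0 < κ) (hκ1 : κ ≤ 1)
    (hrun : ∀ K, RGEqH K β (g K)) (hbox : ∀ K i, i ≤ K → 0 < g K i ∧ g K i ≤ γ) (hpin : ∀ K, g K K = gIR)
    (hS : ScaleShiftRate c θ γ β) (hL : HistLipschitz Λ γ β) (hΛ : ∀ k i, i ≤ k → 0 ≤ Λ k i)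
    (hdepth : ∀ k i, i + N < k → Λ k i = 0) (hrow : ∀ k, ∑ i ∈ range (k + 1), Λ k i ≤ M)
    (hsign : BetaLowerH 0 γ β) (hlo : EventualLowerH b γ k₀ β)
    (hsmall : 2 * ((((k₀ : ℝ) + 1) * γ ^ 3 + 2 * γ / b) * M) ≤ κ ^ N) :
    InjectedRate (2 * c / (1 - θ)) 0 κ (fun K j => disc (g K) (g (K + 1)) j) := by
  intro K j hj
  refine ⟨disc_nonneg _ _ _, ?_⟩
  have h := disc_le_geom_of_depth_sign hγ hb hc hθ0 hθ1 hθκ hκ0 hκ1 (hrun K) (hrun (K + 1)) (hbox K) (hbox (K + 1))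
    ((hpin K).trans (hpin (K + 1)).symm) hS hL hΛ hdepth hrow hsign hlo hsmall j hj
  simpa using h

/-- **THE CONTINUUM RUNNING COUPLING FROM A MEMORY OF FINITE DEPTH (sign form; `T4ContinuumCoupling` BY NAME).**  As
`injectedRate_of_depth_sign` with `κ < 1`: `T4ContinuumCoupling.ContinuumRunning β g g_IR γ b`. [folklore] -/
theorem continuumRunning_of_depth_sign {β : HBeta} {γ b c θ κ M : ℝ} {k₀ N : ℕ} {Λ : ℕ → ℕ → ℝ} (g : ℕ → ℕ → ℝ) (gIR : ℝ)
    (hγ : 0 < γ) (hb : 0 < b) (hc : 0 ≤ c) (hθ0 : 0 ≤ θ) (hθ1 : θ < 1) (hθκ : θ ≤ κ) (hκ0 : 0 < κ) (hκ1 : κ < 1)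
    (hrun : ∀ K, RGEqH K β (g K)) (hbox : ∀ K i, i ≤ K → 0 < g K i ∧ g K i ≤ γ) (hpin : ∀ K, g K K = gIR)
    (hS : ScaleShiftRate c θ γ β) (hL : HistLipschitz Λ γ β) (hΛ : ∀ k i, i ≤ k → 0 ≤ Λ k i)
    (hdepth : ∀ k i, i + N < k → Λ k i = 0) (hrow : ∀ k, ∑ i ∈ range (k + 1), Λ k i ≤ M)
    (hsign : BetaLowerH 0 γ β) (hlo : EventualLowerH b γ k₀ β)
    (hsmall : 2 * ((((k₀ : ℝ) + 1) * γ ^ 3 + 2 * γ / b) * M) ≤ κ ^ N) :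
    ContinuumRunning β g gIR γ b :=
  continuumRunning_of_injectedRate hκ1
    (injectedRate_of_depth_sign g gIR hγ hb hc hθ0 hθ1 hθκ hκ0 hκ1.le hrun hbox hpin hS hL hΛ hdepth hrow hsign hlo hsmall)
    hrun hbox hpin hlo hb.le

end Summit.QuantumFields.BalabanUV.Beta.EriceRemainderEnclosureHistoryFadingContinuum

end
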